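import Literature.MathematicalPhysics.QuantumFieldTheory.Balaban1983to89.B12SecondOrder267Concrete

/-!
# `Balaban1983to89.B11Rem289Concrete` — T. Bałaban, *The variational problem and background fields in renormalization group method for
lattice gauge theories*, Commun. Math. Phys. **102** (1985) 277–309 [Balaban1985Variational], the remark on p. 289 after Proposition 3: **«THE
OPERATOR 𝔇(A′) IS AN ANALYTIC FUNCTION IN A′, AND ITS EXPANSION BEGINS WITH A LINEAR TERM IN A′, COMING FROM THE DIFFERENTIATION OF
D^{(2)}(A′) = C^{(2)}(A′). IF WE SUBTRACT THESE TERMS FROM 𝔇(A′), THEN WE GET AN OPERATOR 𝔇₂(A′) FOR WHICH WE HAVE THE BOUND (73) WITH ε₃²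
INSTEAD OF ε₃», FOR THE CONCRETE FIXED POINT `D̃` ON THE `ℤᵈ` CARRIER** — the linear term of `𝔇(A′) = DD̃(A′)` is `h ↦ 2C⁽²⁾(A′, h)` (the
derivative of the quadratic form `C2map A′ A′` of [4] (136)), and the subtracted operator `𝔇₂(A′) = DD̃(A′) − 2C⁽²⁾(A′, ·)` is bounded by
`O(1)·‖A′‖²·‖h‖ ≤ O(1)·ε₃²‖h‖`, one power of `ε₃` better than `𝔇` itself — Cauchy's estimate along complex lines applied to the order-two
remainder `D̃ − C⁽²⁾` (r08's one-variable reading `B11SchwarzRemainder.reading_frakD2`, here for the concrete objects, in operator form)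

statement-level skeleton of published theorems with citation tags; proofs where landed; nothing here is a claim about the Yang–Mills mass gap

PDF held: `paper:balaban1985-cmp102-variational-background` (journal page = PDF page + 276); p. 289 [PDF 13], text layer `p0013.txt` (materialised
by this seat; the sentence is legible there: «The operator 𝔇(A′) is an analytic function in A′, and its expansion begins with a linear term in A′,
coming from the differentiation of D^{(2)}(A′) = C^{(2)}(A′). If we subtract these terms from 𝔇(A′), then we get an operator 𝔇₂(A′) for which we
have the bound (73) with ε₃² instead of ε₃»).

CITATION HEADER / WHAT IS REPRODUCED.  Cell `lit-balaban`, Phase-2 proof seat p06 gen 6 = unit `lit-balaban-p06` (TAKING addendum HOME/STATUS.md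
2026-08-21T17:42:56Z); SKELETON row **B11.Rem@289** (owner r08; so far `proved-existing` = the one-variable Schwarz-lemma reading
`B11SchwarzRemainder.reading_frakD2` on an abstract function with a linear bound).  THIS FILE: the remark for the CONCRETE `D̃` and `C⁽²⁾` of
`B11Eq44Concrete` / `B12SecondOrder267Concrete`, in OPERATOR form (sup norms; the kernel form «(73) with ε₃²» needs the kernel of `H`, [5] Thm 3.12,
abstract in this corner of the tree — rows B11.Eq70–73).

DICTIONARY (as `B11Eq44Concrete` / `B12SecondOrder267Concrete`: tree units, scales absorbed, sup norms).  `𝒴 = 𝔸^S ∋ A′`, `𝒳 = 𝔸^T`;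
`D ↦ D̃ = Dt`, ANY map with the fixed-point characterization (49) + (55)-ball on `‖A′‖ < ε` (hypotheses `hDfix`, `hDball`; exists and is unique:
`exists_Dt_concrete`, `exists_unique_fixedPoint_concrete`); `𝔇(A′) ↦ fderiv ℂ Dt A′` («(δ/δA′)D(A′)», (63)); `D^{(2)}(A′) = C^{(2)}(A′) ↦ C2map L U₀
S T j A′ A′` ((56), `B11Eq56SeriesConcrete.DtN_two`); its differential `h ↦ C2map h A′ + C2map A′ h = 2·C2map A′ h` (symmetry (138) [4],
`C2map_symm`); **`𝔇₂(A′)h ↦ fderiv ℂ Dt A′ h − 2·C2map A′ h`**; print's `C₂` ↦ `C₂(Lʲ)²` with `C₂ = 8·C₁·e^{4cα₀}` written out; the order-two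
remainder constant `K′ = 8K₃ + 12c₂B₀C₂(Lʲ)²` of `B11Eq44Concrete.eq56_order2_concrete` (`K₃ = 2C₂(Lʲ)²/b`, `c₂ = dC₃(Lʲ)²`).  Regime =
`B11Eq44Concrete`'s with «9C₂B₀ε₃ < 1» ((54)) and `3ε ≤ b`; the point `A′` with `2‖A′‖ < ε` (the Cauchy circle `A′ + τh`, `|τ| = ‖A′‖/‖h‖`,
stays in the ball (51)).

WHAT THIS FILE PROVES (theorems only; kernel, 0 sorry, standard axioms), for `j ≤ k` and `D̃` as above:
* §1 the line calculus: `hasDerivAt_Dt_line` (`(d/dτ)D̃(A′ + τh)|₀ = 𝔇(A′)h`, (63)), `C2map_line` (the quadratic form along a line),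
  `hasDerivAt_C2map_line` (`(d/dτ)C⁽²⁾(A′ + τh, A′ + τh)|₀ = 2C⁽²⁾(A′, h)` — «the linear term … coming from the differentiation of D^{(2)}(A′) =
  C^{(2)}(A′)»), `fderiv_Dt_zero` (`𝔇(0) = 0`: the expansion of `𝔇` has no constant term).
* §2 **THE REMARK**: **`norm_frakD2_apply_le`** (`‖𝔇(A′)h − 2C⁽²⁾(A′, h)‖ ≤ 8K′·‖A′‖²·‖h‖` for `2‖A′‖ < ε`), `norm_frakD2_apply_le_sq`
  (`≤ 2K′·ε²·‖h‖` — «the bound … with ε₃² instead of ε₃»).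
NOT CLAIMED: the kernel (exponential-decay) form of the bound, i.e. (73) itself for `𝔇₂` (needs the kernel of `(I + ℜ)⁻¹` and of `H`); anything
about `Λ_j`/scales.  NOT summit progress.
-/

noncomputable section

open scoped BigOperators Topology
open NormedSpace Finset Metric Filter

namespace Literature.MathematicalPhysics.QuantumFieldTheory.Balaban1983to89.B11Rem289Concrete

open B7Prop1Explicit B7Prop1Local B7Prop2Explicit B7Prop3Flat B7Prop4Flat B7Eq92Concrete B7Prop3GeneralLinear
  B7Prop4GeneralLevels B7Prop5GeneralLevels B7Eq136SecondOrder B13Contraction113 B11Eq44Concrete B12SecondOrder267Concrete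

-- `Site` alone would resolve to the torus sites of `Setup.lean`; re-export the `ℤ^d` sites of `B7Prop1Explicit`.
export B7Prop1Explicit (Site)

variable {d : ℕ}

section Regime

variable {𝔸 : Type*} [NormedRing 𝔸] [NormedAlgebra ℂ 𝔸] [CompleteSpace 𝔸] [NormOneClass 𝔸]

variable (L : ℕ) (hL : 2 ≤ L) {G : Subgroup 𝔸ˣ} (hG : AvgClosed d L G) (k : ℕ)
  (U₀ : Site d → Fin d → 𝔸ˣ) (hU₀ : ∀ x κ, U₀ x κ ∈ G) {α₀ : ℝ} (hα : 0 < α₀)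
  (hα3 : C0 d * α₀ ≤ 1 / 3) (hα4 : 4 * α₀ ≤ c2' d L) (h52 : pdev U₀ < α₀ * (((L : ℝ) ^ k)⁻¹) ^ 2)
  {b : ℝ} (hb : 0 < b)
  (hsmall : Real.exp (4 * (800 * ((d : ℝ) + 1) ^ 2 * ((d : ℝ) + 4)) * α₀)
    * (1 + 8 * (131072 * ((d : ℝ) + 1) ^ 2) * ((L : ℝ) ^ k * b)) ≤ 2)
  (hc₃ : 4 * ((L : ℝ) ^ k * b) < c3 d L)
  (h145 : 8 * d * thetaGen d L α₀ * (L : ℝ)⁻¹ ^ 4 ≤ 1)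
  (h155 : (2 * (L : ℝ) - 1) * (L : ℝ)⁻¹ ^ 2 + 2 * d * thetaGen d L α₀ * (L : ℝ)⁻¹ ^ 3
    + 1 / 8 * (1 + 2 * d * thetaGen d L α₀ * (L : ℝ)⁻¹ ^ 2 + 2 * d * C3Gen d L * ((L : ℝ) ^ k * b)) * (L : ℝ)⁻¹ ^ 2 ≤ 1)
  (S T : Finset (Site d × Fin d)) (hop : (T → 𝔸) →ₗ[ℂ] (S → 𝔸)) {B₀ ε : ℝ} {Dt : (S → 𝔸) → (T → 𝔸)}

-- print's `C₂` of (44)/(55) = [4] (135), `8·C₁·e^{4cα₀}`, is written out below (no local notation).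

/-! ## §1 Line calculus: `𝔇(A′)h` and the linear term `2C⁽²⁾(A′, h)` -/

include hL hG hU₀ hα hα3 hα4 h52 hb hsmall hc₃ in
/-- **`(d/dτ)D̃(A′ + τh)|₀ = 𝔇(A′)h`** ((63) «⟨(δ/δA′)D(A′), δA′⟩ = (d/dτ)D(A′ + τδA′)|_{τ=0}»), for `‖A′‖ < ε`: `D̃` is analytic on the ball (51)
(`B12SecondOrder267Concrete.analyticOnNhd_Dt_concrete`). [cite: Balaban1985Variational, (63) p.287, (54) p.286] -/
theorem hasDerivAt_Dt_line {j : ℕ} (hj : j ≤ k) (hB₀ : 0 ≤ B₀) (hHop : ∀ X, ‖hop X‖ ≤ B₀ * ‖X‖)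
    (hq : 9 * ((8 * (131072 * ((d : ℝ) + 1) ^ 2) * Real.exp (4 * (800 * ((d : ℝ) + 1) ^ 2 * ((d : ℝ) + 4)) * α₀))
      * ((L : ℝ) ^ j) ^ 2) * B₀ * ε < 1) (hε : 3 * ε ≤ b)
    (hDball : ∀ B : S → 𝔸, ‖B‖ < ε → Dt B ∈ closedBall (0 : T → 𝔸)
      (4 * ((8 * (131072 * ((d : ℝ) + 1) ^ 2) * Real.exp (4 * (800 * ((d : ℝ) + 1) ^ 2 * ((d : ℝ) + 4)) * α₀))
        * ((L : ℝ) ^ j) ^ 2) * ε ^ 2))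
    (hDfix : ∀ B : S → 𝔸, ‖B‖ < ε → Cmap L U₀ S T j (B - hop (Dt B)) = Dt B) {A' : S → 𝔸} (hA : ‖A'‖ < ε) (h : S → 𝔸) :
    HasDerivAt (fun τ : ℂ => Dt (A' + τ • h)) (fderiv ℂ Dt A' h) 0 := by
  have han := analyticOnNhd_Dt_concrete L hL hG k U₀ hU₀ hα hα3 hα4 h52 hb hsmall hc₃ S T hop hj hB₀ hHop hq hε hDball hDfix
  exact (han A' (mem_ball_zero_iff.2 hA)).differentiableAt.hasFDerivAt.hasLineDerivAt h

include hL hG hU₀ hα hα3 hα4 h52 hb hsmall hc₃ in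
/-- the quadratic form along a line: `C⁽²⁾(A′ + τh, A′ + τh) = C⁽²⁾(A′, A′) + τ·2C⁽²⁾(A′, h) + τ²·C⁽²⁾(h, h)` (bilinearity and the symmetry (138) of
[4], `B11Eq44Concrete.C2map_symm`). [cite: Balaban1985Variational, (56) p.286] [cite: Balaban1985Averaging, (138) p.39] -/
theorem C2map_line {j : ℕ} (hj : j ≤ k) (A' h : S → 𝔸) (τ : ℂ) :
    C2map L U₀ S T j (A' + τ • h) (A' + τ • h) =
      C2map L U₀ S T j A' A' + τ • ((2 : ℂ) • C2map L U₀ S T j A' h) + τ ^ 2 • C2map L U₀ S T j h h := by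
  have hsym : C2map L U₀ S T j h A' = C2map L U₀ S T j A' h :=
    C2map_symm L hL hG k U₀ hU₀ hα hα3 hα4 h52 hb hsmall hc₃ S T hj h A'
  simp only [map_add, map_smul, LinearMap.add_apply, LinearMap.smul_apply, hsym]
  module

include hL hG hU₀ hα hα3 hα4 h52 hb hsmall hc₃ in
/-- **THE LINEAR TERM OF `𝔇`**: `(d/dτ)C⁽²⁾(A′ + τh, A′ + τh)|₀ = 2C⁽²⁾(A′, h)` — «its expansion begins with a linear term in A′, coming from the
differentiation of D^{(2)}(A′) = C^{(2)}(A′)». [cite: Balaban1985Variational, p.289 (remark after Prop. 3), (56) p.286] -/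
theorem hasDerivAt_C2map_line {j : ℕ} (hj : j ≤ k) (A' h : S → 𝔸) :
    HasDerivAt (fun τ : ℂ => C2map L U₀ S T j (A' + τ • h) (A' + τ • h)) ((2 : ℂ) • C2map L U₀ S T j A' h) 0 := by
  have hfun : (fun τ : ℂ => C2map L U₀ S T j (A' + τ • h) (A' + τ • h)) = fun τ : ℂ =>
      C2map L U₀ S T j A' A' + τ • ((2 : ℂ) • C2map L U₀ S T j A' h) + τ ^ 2 • C2map L U₀ S T j h h :=
    funext fun τ => C2map_line L hL hG k U₀ hU₀ hα hα3 hα4 h52 hb hsmall hc₃ S T hj A' h τ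
  rw [hfun]
  set C : T → 𝔸 := C2map L U₀ S T j A' A'
  set v : T → 𝔸 := (2 : ℂ) • C2map L U₀ S T j A' h
  set w : T → 𝔸 := C2map L U₀ S T j h h
  have h1 : HasDerivAt (fun y : ℂ => C + id y • v + id y ^ 2 • w)
      ((1 : ℂ) • v + (((2 : ℕ) : ℂ) * id (0 : ℂ) ^ (2 - 1) * 1) • w) 0 :=
    (((hasDerivAt_id (0 : ℂ)).smul_const v).const_add C).add (((hasDerivAt_id (0 : ℂ)).pow 2).smul_const w)
  convert h1 using 1 <;> simp

include hL hG hU₀ hα hα3 hα4 h52 hb hsmall hc₃ in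
/-- **`𝔇(0) = 0`**: the expansion of `𝔇` has no constant term ((55): `D̃ = O(‖A′‖²)`; `B12SecondOrder267Concrete.p267_second_order_concrete` (i)).
[cite: Balaban1985Variational, p.289 (remark after Prop. 3), (55) p.286] -/
theorem fderiv_Dt_zero {j : ℕ} (hj : j ≤ k) (hB₀ : 0 ≤ B₀) (hHop : ∀ X, ‖hop X‖ ≤ B₀ * ‖X‖)
    (hq : 9 * ((8 * (131072 * ((d : ℝ) + 1) ^ 2) * Real.exp (4 * (800 * ((d : ℝ) + 1) ^ 2 * ((d : ℝ) + 4)) * α₀))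
      * ((L : ℝ) ^ j) ^ 2) * B₀ * ε < 1) (hε : 3 * ε ≤ b) (hε0 : 0 < ε)
    (hDball : ∀ B : S → 𝔸, ‖B‖ < ε → Dt B ∈ closedBall (0 : T → 𝔸)
      (4 * ((8 * (131072 * ((d : ℝ) + 1) ^ 2) * Real.exp (4 * (800 * ((d : ℝ) + 1) ^ 2 * ((d : ℝ) + 4)) * α₀))
        * ((L : ℝ) ^ j) ^ 2) * ε ^ 2))
    (hDfix : ∀ B : S → 𝔸, ‖B‖ < ε → Cmap L U₀ S T j (B - hop (Dt B)) = Dt B) :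
    fderiv ℂ Dt 0 = 0 :=
  (p267_second_order_concrete L hL hG k U₀ hU₀ hα hα3 hα4 h52 hb hsmall hc₃ S T hop hj hB₀ hHop hq hε hε0 hDball hDfix).1.2

/-! ## §2 The remark: `𝔇₂(A′) = 𝔇(A′) − 2C⁽²⁾(A′, ·)` is `O(‖A′‖²)` -/

include hL hG hU₀ hα hα3 hα4 h52 hb hsmall hc₃ h145 h155 in
/-- **THE p. 289 REMARK FOR THE CONCRETE `D̃`, OPERATOR FORM**: for `2‖A′‖ < ε` and every direction `h`,
`‖𝔇(A′)h − 2C⁽²⁾(A′, h)‖ ≤ 8K′·‖A′‖²·‖h‖` with `K′ = 8K₃ + 12c₂B₀C₂(Lʲ)²` the order-two remainder constant of `B11Eq44Concrete.eq56_order2_concrete`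
(`‖D̃(A) − C⁽²⁾(A, A)‖ ≤ K′‖A‖³` on the ball) — Cauchy's estimate for the derivative at `τ = 0` of the remainder `τ ↦ D̃(A′ + τh) − C⁽²⁾(A′ + τh,
A′ + τh)` on the circle `|τ| = ‖A′‖/‖h‖`, where `‖A′ + τh‖ ≤ 2‖A′‖` and the remainder is `≤ K′(2‖A′‖)³`: «If we subtract these terms from 𝔇(A′),
then we get an operator 𝔇₂(A′) for which we have the bound … with ε₃² instead of ε₃». [cite: Balaban1985Variational, p.289 (remark after Prop. 3), (56) p.286] -/
theorem norm_frakD2_apply_le {j : ℕ} (hj : j ≤ k) (hB₀ : 0 ≤ B₀) (hHop : ∀ X, ‖hop X‖ ≤ B₀ * ‖X‖)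
    (hq : 9 * ((8 * (131072 * ((d : ℝ) + 1) ^ 2) * Real.exp (4 * (800 * ((d : ℝ) + 1) ^ 2 * ((d : ℝ) + 4)) * α₀))
      * ((L : ℝ) ^ j) ^ 2) * B₀ * ε < 1) (hε : 3 * ε ≤ b) (hε0 : 0 < ε)
    (hDball : ∀ B : S → 𝔸, ‖B‖ < ε → Dt B ∈ closedBall (0 : T → 𝔸)
      (4 * ((8 * (131072 * ((d : ℝ) + 1) ^ 2) * Real.exp (4 * (800 * ((d : ℝ) + 1) ^ 2 * ((d : ℝ) + 4)) * α₀))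
        * ((L : ℝ) ^ j) ^ 2) * ε ^ 2))
    (hDfix : ∀ B : S → 𝔸, ‖B‖ < ε → Cmap L U₀ S T j (B - hop (Dt B)) = Dt B) {A' : S → 𝔸} (hA : 2 * ‖A'‖ < ε) (h : S → 𝔸) :
    ‖fderiv ℂ Dt A' h - (2 : ℂ) • C2map L U₀ S T j A' h‖ ≤
      8 * ((8 * (2 * ((8 * (131072 * ((d : ℝ) + 1) ^ 2) * Real.exp (4 * (800 * ((d : ℝ) + 1) ^ 2 * ((d : ℝ) + 4)) * α₀))
          * ((L : ℝ) ^ j) ^ 2 * b⁻¹)) +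
        12 * (d * (C3Gen d L * ((L : ℝ) ^ j) ^ 2)) * B₀ *
          ((8 * (131072 * ((d : ℝ) + 1) ^ 2) * Real.exp (4 * (800 * ((d : ℝ) + 1) ^ 2 * ((d : ℝ) + 4)) * α₀)) * ((L : ℝ) ^ j) ^ 2)))
        * ‖A'‖ ^ 2 * ‖h‖ := by
  -- the remainder constant
  set K : ℝ := (8 * (2 * ((8 * (131072 * ((d : ℝ) + 1) ^ 2) * Real.exp (4 * (800 * ((d : ℝ) + 1) ^ 2 * ((d : ℝ) + 4)) * α₀))
          * ((L : ℝ) ^ j) ^ 2 * b⁻¹)) +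
        12 * (d * (C3Gen d L * ((L : ℝ) ^ j) ^ 2)) * B₀ *
          ((8 * (131072 * ((d : ℝ) + 1) ^ 2) * Real.exp (4 * (800 * ((d : ℝ) + 1) ^ 2 * ((d : ℝ) + 4)) * α₀)) * ((L : ℝ) ^ j) ^ 2))
    with hK
  have hC3 : 0 ≤ C3Gen d L := by unfold C3Gen C1ppGen; positivity
  have hK0 : 0 ≤ K := by
    have := hb.le
    positivity
  have hAε : ‖A'‖ < ε := by linarith [norm_nonneg A']
  -- trivial directions and the trivial point
  by_cases hh : h = 0
  · subst hh
    simp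
  by_cases hA0 : A' = 0
  · subst hA0
    rw [fderiv_Dt_zero L hL hG k U₀ hU₀ hα hα3 hα4 h52 hb hsmall hc₃ S T hop hj hB₀ hHop hq hε hε0 hDball hDfix]
    simp
  have hApos : 0 < ‖A'‖ := norm_pos_iff.2 hA0
  have hhpos : 0 < ‖h‖ := norm_pos_iff.2 hh
  -- the Cauchy circle `|τ| = r = ‖A′‖/‖h‖`
  set r : ℝ := ‖A'‖ / ‖h‖ with hr
  have hr0 : 0 < r := div_pos hApos hhpos
  have hrh : r * ‖h‖ = ‖A'‖ := by rw [hr]; field_simp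
  have hpt : ∀ τ : ℂ, ‖τ‖ ≤ r → ‖A' + τ • h‖ ≤ 2 * ‖A'‖ := by
    intro τ hτ
    calc ‖A' + τ • h‖ ≤ ‖A'‖ + ‖τ • h‖ := norm_add_le _ _
      _ = ‖A'‖ + ‖τ‖ * ‖h‖ := by rw [norm_smul]
      _ ≤ ‖A'‖ + r * ‖h‖ := by nlinarith [norm_nonneg h]
      _ = 2 * ‖A'‖ := by rw [hrh]; ring
  have hptε : ∀ τ : ℂ, ‖τ‖ ≤ r → ‖A' + τ • h‖ < ε := fun τ hτ => (hpt τ hτ).trans_lt hA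
  -- the remainder along the line
  set g : ℂ → (T → 𝔸) := fun τ => Dt (A' + τ • h) - C2map L U₀ S T j (A' + τ • h) (A' + τ • h) with hg
  have han := analyticOnNhd_Dt_concrete L hL hG k U₀ hU₀ hα hα3 hα4 h52 hb hsmall hc₃ S T hop hj hB₀ hHop hq hε hDball hDfix
  -- (a) it is differentiable on the closed disc
  have hdiff : ∀ τ : ℂ, ‖τ‖ ≤ r → DifferentiableAt ℂ g τ := by
    intro τ hτ
    have hD : DifferentiableAt ℂ (fun σ : ℂ => Dt (A' + σ • h)) τ := by
      have h1 : DifferentiableAt ℂ Dt (A' + τ • h) :=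
        (han _ (mem_ball_zero_iff.2 (hptε τ hτ))).differentiableAt
      have h2 : DifferentiableAt ℂ (fun σ : ℂ => A' + σ • h) τ :=
        (differentiableAt_const _).add (differentiableAt_id.smul_const h)
      exact h1.comp τ h2
    have hQ : DifferentiableAt ℂ (fun σ : ℂ => C2map L U₀ S T j (A' + σ • h) (A' + σ • h)) τ := by
      have hfun : (fun σ : ℂ => C2map L U₀ S T j (A' + σ • h) (A' + σ • h)) = fun σ : ℂ =>
          C2map L U₀ S T j A' A' + σ • ((2 : ℂ) • C2map L U₀ S T j A' h) + σ ^ 2 • C2map L U₀ S T j h h :=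
        funext fun σ => C2map_line L hL hG k U₀ hU₀ hα hα3 hα4 h52 hb hsmall hc₃ S T hj A' h σ
      rw [hfun]
      exact ((differentiableAt_const _).add (differentiableAt_id.smul_const _)).add
        ((differentiableAt_id.pow 2).smul_const _)
    exact hD.sub hQ
  have hdc : DiffContOnCl ℂ g (ball (0 : ℂ) r) := by
    refine (DifferentiableOn.mono (fun τ hτ => (hdiff τ ?_).differentiableWithinAt) closure_ball_subset_closedBall).diffContOnCl
    exact mem_closedBall_zero_iff.1 hτ
  -- (b) on the circle the remainder is `≤ K′(2‖A′‖)³`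
  have hsph : ∀ τ ∈ sphere (0 : ℂ) r, ‖g τ‖ ≤ K * (2 * ‖A'‖) ^ 3 := by
    intro τ hτ
    have hτn : ‖τ‖ = r := by simpa using hτ
    have hAτ : ‖A' + τ • h‖ < ε := hptε τ hτn.le
    have h56 := eq56_order2_concrete L hL hG k U₀ hU₀ hα hα3 hα4 h52 hb hsmall hc₃ h145 h155 S T hop hj hB₀ hHop hAτ hq hε
      (hDball _ hAτ) (hDfix _ hAτ)
    refine h56.trans ?_
    rw [← hK]
    exact mul_le_mul_of_nonneg_left (pow_le_pow_left₀ (norm_nonneg _) (hpt τ hτn.le) 3) hK0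
  -- (c) Cauchy's estimate for the derivative at `0`
  have hderiv : deriv g 0 = fderiv ℂ Dt A' h - (2 : ℂ) • C2map L U₀ S T j A' h := by
    have h1 := hasDerivAt_Dt_line L hL hG k U₀ hU₀ hα hα3 hα4 h52 hb hsmall hc₃ S T hop hj hB₀ hHop hq hε hDball hDfix hAε h
    have h2 := hasDerivAt_C2map_line L hL hG k U₀ hU₀ hα hα3 hα4 h52 hb hsmall hc₃ S T hj A' h
    exact (h1.sub h2).deriv
  have hC := Complex.norm_deriv_le_of_forall_mem_sphere_norm_le hr0 hdc hsph
  rw [hderiv] at hC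
  refine hC.trans (le_of_eq ?_)
  rw [hr]
  field_simp
  ring

include hL hG hU₀ hα hα3 hα4 h52 hb hsmall hc₃ h145 h155 in
/-- **«THE BOUND … WITH ε₃² INSTEAD OF ε₃»**: for `2‖A′‖ < ε`, `‖𝔇₂(A′)h‖ ≤ 2K′·ε²·‖h‖` (`‖A′‖² < ε²/4` in `norm_frakD2_apply_le`).
[cite: Balaban1985Variational, p.289 (remark after Prop. 3)] -/
theorem norm_frakD2_apply_le_sq {j : ℕ} (hj : j ≤ k) (hB₀ : 0 ≤ B₀) (hHop : ∀ X, ‖hop X‖ ≤ B₀ * ‖X‖)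
    (hq : 9 * ((8 * (131072 * ((d : ℝ) + 1) ^ 2) * Real.exp (4 * (800 * ((d : ℝ) + 1) ^ 2 * ((d : ℝ) + 4)) * α₀))
      * ((L : ℝ) ^ j) ^ 2) * B₀ * ε < 1) (hε : 3 * ε ≤ b) (hε0 : 0 < ε)
    (hDball : ∀ B : S → 𝔸, ‖B‖ < ε → Dt B ∈ closedBall (0 : T → 𝔸)
      (4 * ((8 * (131072 * ((d : ℝ) + 1) ^ 2) * Real.exp (4 * (800 * ((d : ℝ) + 1) ^ 2 * ((d : ℝ) + 4)) * α₀))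
        * ((L : ℝ) ^ j) ^ 2) * ε ^ 2))
    (hDfix : ∀ B : S → 𝔸, ‖B‖ < ε → Cmap L U₀ S T j (B - hop (Dt B)) = Dt B) {A' : S → 𝔸} (hA : 2 * ‖A'‖ < ε) (h : S → 𝔸) :
    ‖fderiv ℂ Dt A' h - (2 : ℂ) • C2map L U₀ S T j A' h‖ ≤
      2 * ((8 * (2 * ((8 * (131072 * ((d : ℝ) + 1) ^ 2) * Real.exp (4 * (800 * ((d : ℝ) + 1) ^ 2 * ((d : ℝ) + 4)) * α₀))
          * ((L : ℝ) ^ j) ^ 2 * b⁻¹)) +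
        12 * (d * (C3Gen d L * ((L : ℝ) ^ j) ^ 2)) * B₀ *
          ((8 * (131072 * ((d : ℝ) + 1) ^ 2) * Real.exp (4 * (800 * ((d : ℝ) + 1) ^ 2 * ((d : ℝ) + 4)) * α₀)) * ((L : ℝ) ^ j) ^ 2)))
        * ε ^ 2 * ‖h‖ := by
  have h1 := norm_frakD2_apply_le L hL hG k U₀ hU₀ hα hα3 hα4 h52 hb hsmall hc₃ h145 h155 S T hop hj hB₀ hHop hq hε hε0 hDball hDfix
    hA h
  have hC3 : 0 ≤ C3Gen d L := by unfold C3Gen C1ppGen; positivity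
  have hK0 : 0 ≤ (8 * (2 * ((8 * (131072 * ((d : ℝ) + 1) ^ 2) * Real.exp (4 * (800 * ((d : ℝ) + 1) ^ 2 * ((d : ℝ) + 4)) * α₀))
          * ((L : ℝ) ^ j) ^ 2 * b⁻¹)) +
        12 * (d * (C3Gen d L * ((L : ℝ) ^ j) ^ 2)) * B₀ *
          ((8 * (131072 * ((d : ℝ) + 1) ^ 2) * Real.exp (4 * (800 * ((d : ℝ) + 1) ^ 2 * ((d : ℝ) + 4)) * α₀)) * ((L : ℝ) ^ j) ^ 2)) := by
    have := hb.le
    positivity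
  have hsq : ‖A'‖ ^ 2 ≤ ε ^ 2 / 4 := by nlinarith [norm_nonneg A']
  refine h1.trans ?_
  have hh := norm_nonneg h
  nlinarith [mul_nonneg hK0 hh, mul_nonneg (mul_nonneg hK0 hh) (sub_nonneg.2 hsq)]

end Regime

end Literature.MathematicalPhysics.QuantumFieldTheory.Balaban1983to89.B11Rem289Concrete

end
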